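import Mathlib
import Summits.ValiantsHypothesis.ValiantsHypothesis.Theorems.BarrierLeverPartitionMinorsHitByVPHiddenStatesSymbolic

/-!
# Route BarrierLever — item `PartitionMinorsHitByVP` (stmt-ValiantsHypothesis-19717), line `hidden-states`:
# THE ANTIPODAL TABLE, WEIGHTED — every SELF-DUAL THRESHOLD PIECE is good for the full cube

Helper file (`--supports stmt-ValiantsHypothesis-19717`; cell valiant-natproofs, rung V4, 𝒟-side door (c), registered line
`Cruxes/PartitionMinorsHitByVP/Lines/hidden_states.lean`, lane `stub_universalJoinWide`; prover seat val-np-p6 gen 8).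
No definitions. Closes NO item.

THE POINT (memo val-np-p6 g8 «cut-tree certifiability» §3; generalises `…HiddenStatesAntipodal` = the case `w ≡ 1`). A legal piece of
the line is a knapsack family `{J : Σ_{q∈J} w_q ≤ τ}` on its states. Call it SELF-DUAL when the total weight is `2τ + 1`: then `J ↦ Jᶜ`
pairs `{w(J) ≤ τ}` with `{w(J) ≥ τ+1}`, so the piece has exactly `2^n` of the `2^{n+1}` subsets of its `n+1` states. THEOREM
(`symGood_selfDual_cube`): every self-dual threshold piece on `n+1` states is generically good for the FULL `n`-cube (rows = all subsets of
`Fin n`). ONE explicit table (the ANTIPODAL TABLE): base `0`, state `j < n ↦ e_j`, state `n ↦ −𝟙`. A member `J ∌ n` sits at `1_J` (column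
`[U ⊆ J]`); a member `J' ∪ {n}` at `1_{J'} − 𝟙 = −1_{J'ᶜ}` (column `(−1)^{|U|}[U ⊆ J'ᶜ]`), and self-duality says the complements `J'ᶜ`
(`w(J') ≤ τ − w_n`) are exactly the sets of weight `≥ τ + 1`, i.e. exactly the non-members among subsets of `Fin n`: up to row signs the
matrix is the zeta matrix of the whole lattice `2^{[n]}`. Proof = two-phase elimination (top columns by a minimal counterexample and the
weight count `W ≤ w(J ∪ J₀) ≤ 2τ`, bottom columns by `TwoLayer.eq_zero_of_zeta`). Examples: `B_t(2t+1)` (w ≡ 1), `B_t(2t+1) × cube`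
(zero weights), `W(1^{m₁} 2^{m₂} 4^{m₄}…)` with `m₁` odd, `{J : J ∩ {a,b,c} has ≤ 1 element}`-type pieces (w = (1,1,1) ∪ 0s, τ = 1), … .
Numeric form `exists_table_selfDual_cube`.

WHAT THIS IS NOT: the rows are the FULL cube only; says nothing about universality of any design; item 19717 OPEN; nothing on
crux 14610 or VP ≠ VNP.
-/

set_option linter.dupNamespace false

namespace Summit.ValiantsHypothesis.ValiantsHypothesis.Theorems.BarrierLever.HiddenStates

open Finset Matrix MvPolynomial

noncomputable section

namespace SymbJoin

variable {m K r : ℕ}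

/-! ## 1. The antipodal table and its hidden points -/

/-- The hidden point of a column with member set `J.map ι` under the antipodal table: coordinate `a` equals
`[castSucc a ∈ J] − [last ∈ J]`. -/
theorem antipodalW_point (n : ℕ) (ι : Fin (n + 1) ↪ Fin K) (J : Finset (Fin (n + 1))) (a : Fin n) :
    (0 : ℂ) + ∑ q ∈ J.map ι,
        (if q = ι (Fin.last n) then (-1 : ℂ) else if q = ι (Fin.castSucc a) then 1 else 0)
      = (if Fin.castSucc a ∈ J then (1 : ℂ) else 0) - (if Fin.last n ∈ J then (1 : ℂ) else 0) := by
  classical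
  rw [zero_add, Finset.sum_map]
  have hne : Fin.castSucc a ≠ Fin.last n := fun h' => Fin.castSucc_ne_last a h'
  have hsummand : ∀ j ∈ J, (if ι j = ι (Fin.last n) then (-1 : ℂ) else if ι j = ι (Fin.castSucc a) then 1 else 0)
      = (if j = Fin.castSucc a then (1 : ℂ) else 0) - (if j = Fin.last n then (1 : ℂ) else 0) := by
    intro j _
    by_cases h1 : j = Fin.last n
    · subst h1
      rw [if_pos rfl, if_neg (fun h' => hne h'.symm), if_pos rfl]; ring
    · rw [if_neg (fun h' => h1 (ι.injective h')), if_neg h1]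
      by_cases h2 : j = Fin.castSucc a
      · subst h2; rw [if_pos rfl, if_pos rfl]; ring
      · rw [if_neg (fun h' => h2 (ι.injective h')), if_neg h2]; ring
  rw [Finset.sum_congr rfl hsummand, Finset.sum_sub_distrib, Finset.sum_ite_eq' J (Fin.castSucc a),
    Finset.sum_ite_eq' J (Fin.last n)]

/-- Entry of a BOTTOM column (`last ∉ J`): the zeta indicator `[∀ a ∈ U, castSucc a ∈ J]`. -/
theorem antipodalW_entry_bot (n : ℕ) (J : Finset (Fin (n + 1))) (hJ : Fin.last n ∉ J) (U : Finset (Fin n)) :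
    ∏ a ∈ U, ((if Fin.castSucc a ∈ J then (1 : ℂ) else 0) - (if Fin.last n ∈ J then (1 : ℂ) else 0))
      = if (∀ a ∈ U, Fin.castSucc a ∈ J) then 1 else 0 := by
  simp_rw [if_neg hJ, sub_zero]
  by_cases hall : ∀ a ∈ U, Fin.castSucc a ∈ J
  · rw [if_pos hall]
    exact Finset.prod_eq_one fun a ha => if_pos (hall a ha)
  · rw [if_neg hall]
    push Not at hall
    obtain ⟨a, ha, hna⟩ := hall
    exact Finset.prod_eq_zero ha (if_neg hna)

/-- Entry of a TOP column (`last ∈ J`): `(−1)^{|U|} · [∀ a ∈ U, castSucc a ∉ J]`. -/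
theorem antipodalW_entry_top (n : ℕ) (J : Finset (Fin (n + 1))) (hJ : Fin.last n ∈ J) (U : Finset (Fin n)) :
    ∏ a ∈ U, ((if Fin.castSucc a ∈ J then (1 : ℂ) else 0) - (if Fin.last n ∈ J then (1 : ℂ) else 0))
      = (-1) ^ U.card * (if (∀ a ∈ U, Fin.castSucc a ∉ J) then 1 else 0) := by
  simp_rw [if_pos hJ]
  by_cases hall : ∀ a ∈ U, Fin.castSucc a ∉ J
  · rw [if_pos hall, mul_one]
    rw [Finset.prod_congr rfl (fun a ha => by rw [if_neg (hall a ha), zero_sub]), Finset.prod_const]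
  · rw [if_neg hall, mul_zero]
    push Not at hall
    obtain ⟨a, ha, hna⟩ := hall
    exact Finset.prod_eq_zero ha (by rw [if_pos hna, sub_self])

/-! ## 2. The theorem -/

/-- **SELF-DUAL THRESHOLD PIECES ARE GOOD FOR THE CUBE.** Let the rows `u` run through ALL subsets of `Fin n` (bijectively) and let the
columns have member sets `(J k).map ι` for an injective family `J` of subsets of `Fin (n + 1)` of weight `Σ_{q ∈ J k} w q ≤ τ`, where the
total weight is `Σ_q w q = 2τ + 1` (so, by counting, the members are exactly the self-dual threshold family; the pieces `(e k).1` are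
arbitrary). Then the configuration is generically good: `symDet u e ≠ 0`. -/
theorem symGood_selfDual_cube (n τ : ℕ) (w : Fin (n + 1) → ℕ) (hW : ∑ q, w q = 2 * τ + 1)
    (u : Fin r → Finset (Fin n)) (hu : Function.Bijective u)
    (e : Fin r → Fin m × Finset (Fin K)) (ι : Fin (n + 1) ↪ Fin K) (J : Fin r → Finset (Fin (n + 1)))
    (hJ : Function.Injective J) (hwt : ∀ k, ∑ q ∈ J k, w q ≤ τ) (he : ∀ k, (e k).2 = (J k).map ι) :
    symDet u e ≠ 0 := by
  classical
  -- the antipodal table (the same for every piece)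
  let tx : Fin m → Option (Fin K) → Fin n → ℂ := fun _ o a =>
    match o with
    | none => 0
    | some q => if q = ι (Fin.last n) then -1 else if q = ι (Fin.castSucc a) then 1 else 0
  refine symGood_of_table u e tx ?_
  -- hidden points
  have hpt : ∀ k a, tx (e k).1 none a + ∑ q ∈ (e k).2, tx (e k).1 (some q) a
      = (if Fin.castSucc a ∈ J k then (1 : ℂ) else 0) - (if Fin.last n ∈ J k then (1 : ℂ) else 0) := by
    intro k a
    rw [he k]
    exact antipodalW_point n ι (J k) a
  -- the columns
  let col : Fin r → (Fin r → ℂ) := fun k i =>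
    ∏ a ∈ u i, (tx (e k).1 none a + ∑ q ∈ (e k).2, tx (e k).1 (some q) a)
  have hcol : ∀ k i, col k i = ∏ a ∈ u i,
      ((if Fin.castSucc a ∈ J k then (1 : ℂ) else 0) - (if Fin.last n ∈ J k then (1 : ℂ) else 0)) := by
    intro k i
    simp only [col]
    exact Finset.prod_congr rfl fun a _ => hpt k a
  have hbot : ∀ k i, Fin.last n ∉ J k → col k i = if (∀ a ∈ u i, Fin.castSucc a ∈ J k) then 1 else 0 := by
    intro k i hk; rw [hcol, antipodalW_entry_bot n (J k) hk]
  have htop : ∀ k i, Fin.last n ∈ J k →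
      col k i = (-1) ^ (u i).card * (if (∀ a ∈ u i, Fin.castSucc a ∉ J k) then 1 else 0) := by
    intro k i hk; rw [hcol, antipodalW_entry_top n (J k) hk]
  -- suppose the matrix is singular
  intro hdet
  obtain ⟨α, hαne, hαmul⟩ := Matrix.exists_mulVec_eq_zero_iff.mpr hdet
  apply hαne
  have hsum : ∑ k, α k • col k = 0 := by
    funext i
    have := congrFun hαmul i
    rw [Matrix.mulVec, dotProduct] at this
    simp only [Matrix.of_apply, Pi.zero_apply] at this
    rw [Finset.sum_apply, Pi.zero_apply]
    simpa [col, Pi.smul_apply, smul_eq_mul, mul_comm] using this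
  have hrow : ∀ i, ∑ k, α k * col k i = 0 := by
    intro i
    have := congrFun hsum i
    rw [Finset.sum_apply, Pi.zero_apply] at this
    simpa [Pi.smul_apply, smul_eq_mul] using this
  -- PHASE A: every TOP column (last ∈ J k) has coefficient zero
  have htopzero : ∀ k, Fin.last n ∈ J k → α k = 0 := by
    by_contra hcon
    push Not at hcon
    -- a top counterexample with |J k| minimal
    obtain ⟨k₀, hk₀, hmin⟩ := Finset.exists_min_image
      (Finset.univ.filter fun k => Fin.last n ∈ J k ∧ α k ≠ 0) (fun k => (J k).card)
      (by obtain ⟨k, hk1, hk2⟩ := hcon; exact ⟨k, by simp [hk1, hk2]⟩)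
    simp only [Finset.mem_filter, Finset.mem_univ, true_and] at hk₀
    obtain ⟨hk₀top, hk₀ne⟩ := hk₀
    -- the row U₀ = { a : castSucc a ∉ J k₀ }
    obtain ⟨i₀, hi₀⟩ := hu.2 (Finset.univ.filter fun a : Fin n => Fin.castSucc a ∉ J k₀)
    have hmemU : ∀ a, a ∈ u i₀ ↔ Fin.castSucc a ∉ J k₀ := by
      intro a; rw [hi₀]; simp
    have hrel := hrow i₀
    rw [Finset.sum_eq_single k₀] at hrel
    · -- the diagonal entry is ± α k₀
      rw [htop k₀ i₀ hk₀top, if_pos (fun a ha => (hmemU a).mp ha)] at hrel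
      have : α k₀ * (-1) ^ (u i₀).card = 0 := by simpa using hrel
      rcases mul_eq_zero.mp this with h' | h'
      · exact hk₀ne h'
      · exact absurd h' (pow_ne_zero _ (by norm_num))
    · intro k _ hk
      by_cases hkt : Fin.last n ∈ J k
      · -- top column k ≠ k₀: nonzero entry forces J k ⊊ J k₀, then minimality gives α k = 0
        rw [htop k i₀ hkt]
        by_cases hall : ∀ a ∈ u i₀, Fin.castSucc a ∉ J k
        · -- then J k ⊆ J k₀
          have hsub : J k ⊆ J k₀ := by
            intro j hj
            rcases Fin.eq_castSucc_or_eq_last j with ⟨a, rfl⟩ | rfl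
            · by_contra hja
              exact hall a ((hmemU a).mpr hja) hj
            · exact hk₀top
          have hss : J k ⊂ J k₀ := lt_of_le_of_ne hsub (fun h' => hk (hJ h'))
          have hlt : (J k).card < (J k₀).card := Finset.card_lt_card hss
          have hαk : α k = 0 := by
            by_contra h'
            have := hmin k (by simp [hkt, h'])
            omega
          rw [hαk, zero_mul]
        · rw [if_neg hall, mul_zero, mul_zero]
      · -- bottom column: its entry at U₀ vanishes by counting
        rw [hbot k i₀ hkt]
        by_cases hall : ∀ a ∈ u i₀, Fin.castSucc a ∈ J k
        · exfalso
          -- every element of Fin (2t+1) lies in J k ∪ J k₀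
          have hcover : (Finset.univ : Finset (Fin (n + 1))) ⊆ J k ∪ J k₀ := by
            intro j _
            rw [Finset.mem_union]
            rcases Fin.eq_castSucc_or_eq_last j with ⟨a, rfl⟩ | rfl
            · by_cases hja : Fin.castSucc a ∈ J k₀
              · exact Or.inr hja
              · exact Or.inl (hall a ((hmemU a).mpr hja))
            · exact Or.inr hk₀top
          have h1 : ∑ q, w q ≤ ∑ q ∈ J k ∪ J k₀, w q := Finset.sum_le_sum_of_subset hcover
          have h2 : ∑ q ∈ J k ∪ J k₀, w q ≤ ∑ q ∈ J k, w q + ∑ q ∈ J k₀, w q := by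
            rw [← Finset.sum_union_inter]; exact Nat.le_add_right _ _
          have h3 := hwt k
          have h4 := hwt k₀
          omega
        · rw [if_neg hall, mul_zero]
    · intro h'; exact absurd (Finset.mem_univ k₀) h'
  -- PHASE B: the bottom columns form a zeta pattern on their copy rows
  let A : Finset (Fin r) := Finset.univ.filter fun k => Fin.last n ∉ J k
  -- copy row of a bottom column: the row { a : castSucc a ∈ J k }
  have hrowex : ∀ k, ∃ i, u i = Finset.univ.filter fun a : Fin n => Fin.castSucc a ∈ J k := fun k => hu.2 _
  choose ρ hρ using hrowex
  have hzeta : ∀ k ∈ A, ∀ k' ∈ A, col k' (ρ k) = if J k ⊆ J k' then 1 else 0 := by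
    intro k hk k' hk'
    simp only [A, Finset.mem_filter, Finset.mem_univ, true_and] at hk hk'
    rw [hbot k' (ρ k) hk']
    have hiff : (∀ a ∈ u (ρ k), Fin.castSucc a ∈ J k') ↔ J k ⊆ J k' := by
      rw [hρ k]
      constructor
      · intro hall j hj
        rcases Fin.eq_castSucc_or_eq_last j with ⟨a, rfl⟩ | rfl
        · exact hall a (by simp [hj])
        · exact absurd hj hk
      · intro hsub a ha
        simp only [Finset.mem_filter, Finset.mem_univ, true_and] at ha
        exact hsub ha
    by_cases hs : J k ⊆ J k'
    · rw [if_pos hs, if_pos (hiff.mpr hs)]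
    · rw [if_neg hs, if_neg (fun h' => hs (hiff.mp h'))]
  have hαA : ∀ k, k ∉ A → α k = 0 := by
    intro k hk
    simp only [A, Finset.mem_filter, Finset.mem_univ, true_and, not_not] at hk
    exact htopzero k hk
  funext k
  exact TwoLayer.eq_zero_of_zeta J hJ col A ρ hzeta α hαA hsum k

/-- Numeric form: a self-dual threshold piece has a table whose block-additive matrix against the full cube is nonsingular. -/
theorem exists_table_selfDual_cube (n τ : ℕ) (w : Fin (n + 1) → ℕ) (hW : ∑ q, w q = 2 * τ + 1)
    (u : Fin r → Finset (Fin n)) (hu : Function.Bijective u)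
    (e : Fin r → Fin m × Finset (Fin K)) (ι : Fin (n + 1) ↪ Fin K) (J : Fin r → Finset (Fin (n + 1)))
    (hJ : Function.Injective J) (hwt : ∀ k, ∑ q ∈ J k, w q ≤ τ) (he : ∀ k, (e k).2 = (J k).map ι) :
    ∃ tx : Fin m → Option (Fin K) → Fin n → ℂ,
      (Matrix.of fun i k : Fin r =>
        ∏ a ∈ u i, (tx (e k).1 none a + ∑ q ∈ (e k).2, tx (e k).1 (some q) a)).det ≠ 0 :=
  exists_table_of_symGood u e (symGood_selfDual_cube n τ w hW u hu e ι J hJ hwt he)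

end SymbJoin

end

end Summit.ValiantsHypothesis.ValiantsHypothesis.Theorems.BarrierLever.HiddenStates
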